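import Summits.ABC.ABC.Theses.IsogenyGlueCongruence
import Summits.ABC.ABC.Theorems.SharpDegreeOfPolyDegree.Negative.ExponentFloor
import Summits.ABC.ABC.Theorems.IsogenyGlueCongruenceSharpDegreeOfPolyHeightPosition
import Literature.Barriers.ABC.SzpiroEpsilonCannotBeDroppedHolds

-- `Summit.ABC.ABC.…`: summit and sub-problem share the name `ABC` (single-conjunct summit, D-0017).
set_option linter.dupNamespace false

/-!
# `SharpDegreeOfPolyHeight` (stmt-ABC-16009) — negative lemmas: the polylogarithmic floor of the
# hypothesis, and the item with a smaller consequent exponent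

`R' := SharpDegreeOfPolyHeight = (H → X)`, `H = ∃ σ C, max(|Δ_W|, |c₄(W)|³) ≤ C · N_W^σ` over
semistable globally minimal elliptic `W/ℚ` (polynomial height conjecture), `X =
SemistableDegreeConjecture` (`∀ ε > 0 ∃ C, deg φ ≤ C · N^{2+ε}` for SOME parametrisation datum of every
such curve).  cdisprove seat `refuter-cdisprove-stmt-ABC-16009-0` (2026-08-16), kernel-checked
attacks on natural STRENGTHENINGS of the item; companion of `HypothesisFloor.lean` (p117587) and of
`ConsequentFloor.lean` (the `ε = 0` endpoint of the consequent).

1. `not_polyHeight_polylog` — the hypothesis cannot even hold in the form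
   `max(|Δ|, |c₄|³) ≤ C · N⁶ · (log N)^k` (any real `C, k`): Masser's semistable curves
   (`Literature.Barriers.ABC.Masser.exists_semistable_curve_polylog_excess`, proved) on a global
   minimal model.  Sharpens `not_polyHeightAt_of_le_six` (`k = 0`): the true content of `H` begins
   strictly above every `N⁶ (log N)^k` — exactly where the content of `X` begins on the degree side
   (`ConsequentFloor.lean`) — so `R'` is the pure exponent-LOWERING statement "`H_σ` for one `σ > 6`
   ⟹ `H_{6+ε}` for all `ε > 0`" (modulo the route's named modularity / Petersson inputs).
2. `strengthenedCrux_iff_not_polyHeight_of_lt_three_halves` (unconditional) /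
   `…_of_lt_two` (modulo the route item `PeterssonLowerBound`): the item with the exponent `2` of its
   consequent replaced by `θ < 3/2` (resp. `θ < 2`) holds iff `H` FAILS, hence
   (`not_abc_of_strengthenedCrux_of_lt_three_halves`) only if the summit `ABC` fails
   (`SharpDegreeOfPolyHeight.polyHeight_of_abc`, Bombieri–Gubler 12.5.12, proved in the tree):
   nobody should aim below the exponent `2` when proving `R'`.

Purely negative / boundary content; no Theses statement is asserted, no definition, no named fact.
-/

noncomputable section

namespace Summit.ABC.ABC.Theorems.SharpDegreeOfPolyHeight.Negative

open Summit.ABC.ABC.Theses.IsogenyGlueCongruence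
open Summit.ABC.ABC.Theorems.SharpDegreeOfPolyDegree.Negative
  (exists_globallyMinimal_model not_targetWithExponent_of_lt_three_halves
    not_targetWithExponent_of_lt_two)
open Literature.NumberTheory.EllipticCurves Literature.NumberTheory.EllipticCurves.ModularForms
open WeierstrassCurve

/-! ## 1. The polylogarithmic floor of the hypothesis -/

/-- **`H` fails even with a polylogarithmic allowance at the exponent `6`.** There are no real `C, k`
with `max(|Δ_W|, |c₄(W)|³) ≤ C · N_W⁶ · (log N_W)^k` for every semistable elliptic `W/ℚ` in global
minimal form: Masser's semistable curves with `|Δ_min| > C N⁶ (log N)^k`, transported to a global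
minimal model. [cite: Masser1990, Theorem and Lemma 1] -/
theorem not_polyHeight_polylog :
    ¬ ∃ C k : ℝ, ∀ (W : WeierstrassCurve ℚ) [W.IsElliptic] [W.IsGloballyMinimal]
      [NeZero (W.conductorNorm ℤ)], W.IsSemistable ℤ →
        ((max |W.Δ| (|W.c₄| ^ 3) : ℚ) : ℝ) ≤
          C * (W.conductorNorm ℤ : ℝ) ^ 6 * Real.log (W.conductorNorm ℤ) ^ k := by
  rintro ⟨C, k, h⟩
  obtain ⟨W, hW, hss, hN, hlt⟩ :=
    Literature.Barriers.ABC.Masser.exists_semistable_curve_polylog_excess k C 0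
  haveI := hW
  obtain ⟨W₁, hE₁, hM₁, hss₁, hN₁, hΔ₁⟩ := exists_globallyMinimal_model W
  haveI := hE₁
  haveI := hM₁
  haveI : NeZero (W₁.conductorNorm ℤ) := ⟨by rw [hN₁]; exact hN.ne'⟩
  have h1 := h W₁ (hss₁ hss)
  rw [hN₁] at h1
  have h2 : (W.minimalDiscriminantNorm ℤ : ℝ) ≤ ((max |W₁.Δ| (|W₁.c₄| ^ 3) : ℚ) : ℝ) := by
    rw [← hΔ₁]
    exact Rat.cast_le.mpr (le_max_left _ _)
  exact absurd (h2.trans h1) (not_le.mpr hlt)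

/-! ## 2. The consequent with a smaller exponent: the strengthened item is `¬ H` -/

/-- **Strengthened item ⟺ `¬ H`, unconditionally for `θ < 3/2`.** Replacing the exponent `2` of the
consequent `X` by any `θ < 3/2` turns `R'` into a statement equivalent to the failure of its own
hypothesis (the strengthened consequent is false: `not_targetWithExponent_of_lt_three_halves`,
Masser + Iwaniec + Zagier + Silverman, all proved). [cite: Masser1990, Theorem] -/
theorem strengthenedCrux_iff_not_polyHeight_of_lt_three_halves {θ : ℝ} (hθ : θ < 3 / 2) :
    ((∃ σ C : ℝ, ∀ (W : WeierstrassCurve ℚ) [W.IsElliptic] [W.IsGloballyMinimal]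
        [NeZero (W.conductorNorm ℤ)], W.IsSemistable ℤ →
          ((max |W.Δ| (|W.c₄| ^ 3) : ℚ) : ℝ) ≤ C * (W.conductorNorm ℤ : ℝ) ^ σ) →
      ∀ ε : ℝ, 0 < ε → ∃ C : ℝ, ∀ (W : WeierstrassCurve ℚ) [W.IsElliptic] [W.IsGloballyMinimal]
        [NeZero (W.conductorNorm ℤ)], W.IsSemistable ℤ →
          ∃ D : ModularParametrizationData W (W.conductorNorm ℤ),
            (D.modularDegree : ℝ) ≤ C * (W.conductorNorm ℤ : ℝ) ^ (θ + ε)) ↔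
    ¬ ∃ σ C : ℝ, ∀ (W : WeierstrassCurve ℚ) [W.IsElliptic] [W.IsGloballyMinimal]
        [NeZero (W.conductorNorm ℤ)], W.IsSemistable ℤ →
          ((max |W.Δ| (|W.c₄| ^ 3) : ℚ) : ℝ) ≤ C * (W.conductorNorm ℤ : ℝ) ^ σ :=
  ⟨fun h hH => not_targetWithExponent_of_lt_three_halves hθ (h hH), fun h hH => absurd hH h⟩

/-- **Strengthened item ⟺ `¬ H` for every `θ < 2`, modulo the route item `PeterssonLowerBound`**
(`(f,f) ≫_ε N^{1−ε}`, Hoffstein–Lockhart 1994). [cite: HoffsteinLockhart1994, Thm. 0.1] -/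
theorem strengthenedCrux_iff_not_polyHeight_of_lt_two (hP : PeterssonLowerBound) {θ : ℝ}
    (hθ : θ < 2) :
    ((∃ σ C : ℝ, ∀ (W : WeierstrassCurve ℚ) [W.IsElliptic] [W.IsGloballyMinimal]
        [NeZero (W.conductorNorm ℤ)], W.IsSemistable ℤ →
          ((max |W.Δ| (|W.c₄| ^ 3) : ℚ) : ℝ) ≤ C * (W.conductorNorm ℤ : ℝ) ^ σ) →
      ∀ ε : ℝ, 0 < ε → ∃ C : ℝ, ∀ (W : WeierstrassCurve ℚ) [W.IsElliptic] [W.IsGloballyMinimal]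
        [NeZero (W.conductorNorm ℤ)], W.IsSemistable ℤ →
          ∃ D : ModularParametrizationData W (W.conductorNorm ℤ),
            (D.modularDegree : ℝ) ≤ C * (W.conductorNorm ℤ : ℝ) ^ (θ + ε)) ↔
    ¬ ∃ σ C : ℝ, ∀ (W : WeierstrassCurve ℚ) [W.IsElliptic] [W.IsGloballyMinimal]
        [NeZero (W.conductorNorm ℤ)], W.IsSemistable ℤ →
          ((max |W.Δ| (|W.c₄| ^ 3) : ℚ) : ℝ) ≤ C * (W.conductorNorm ℤ : ℝ) ^ σ :=
  ⟨fun h hH => not_targetWithExponent_of_lt_two hP hθ (h hH), fun h hH => absurd hH h⟩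

/-- **Whoever proves the `θ < 3/2` strengthening of `R'` refutes the summit**: `ABC → H`
(`SharpDegreeOfPolyHeight.polyHeight_of_abc`, Bombieri–Gubler Thm. 12.5.12 restricted to semistable
minimal models, proved in the tree). [cite: BombieriGubler2006, Thm. 12.5.12] -/
theorem not_abc_of_strengthenedCrux_of_lt_three_halves {θ : ℝ} (hθ : θ < 3 / 2)
    (h : (∃ σ C : ℝ, ∀ (W : WeierstrassCurve ℚ) [W.IsElliptic] [W.IsGloballyMinimal]
        [NeZero (W.conductorNorm ℤ)], W.IsSemistable ℤ →
          ((max |W.Δ| (|W.c₄| ^ 3) : ℚ) : ℝ) ≤ C * (W.conductorNorm ℤ : ℝ) ^ σ) →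
      ∀ ε : ℝ, 0 < ε → ∃ C : ℝ, ∀ (W : WeierstrassCurve ℚ) [W.IsElliptic] [W.IsGloballyMinimal]
        [NeZero (W.conductorNorm ℤ)], W.IsSemistable ℤ →
          ∃ D : ModularParametrizationData W (W.conductorNorm ℤ),
            (D.modularDegree : ℝ) ≤ C * (W.conductorNorm ℤ : ℝ) ^ (θ + ε)) : ¬ ABC :=
  fun habc => (strengthenedCrux_iff_not_polyHeight_of_lt_three_halves hθ).mp h
    (Summit.ABC.ABC.Theorems.SharpDegreeOfPolyHeight.polyHeight_of_abc habc)

end Summit.ABC.ABC.Theorems.SharpDegreeOfPolyHeight.Negative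

end
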